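import Summits.AtomisticToContinuum.Crystallization.Theorems.ChartedZeroExcessLayeredLatticeLiouvilleTU

/-!
# Zero-excess layered lattice Liouville — part TV (lens-2 g42 node «FieldRigidityReduction»): (K) ⟸ ONE known-type piece `FieldRigidityP`, seam PROVED

After parts TS (frame compatibility / cell gradient / identification, PROVED) and TU (mean-rotation identification `K_ID`, PROVED) the tilt-rigidity
half (K) `TiltRigidityP` of `R_W` reduces to ONE registration-free, chart-free, `θ`-free statement about rotation FIELDS on clean configurations:

* XXII.2 `FieldRigidityP aHi` (K_F, the ONE new `Prop` of this file, KNOWN-type): on every `aHi`-door set, for every map `Ψ` and every admissible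
  tilt/strain data `(Q, σ)` on the window of radius `R ≥ R_F`, SOME linear map `Q̄` has `Σ_{win R} ‖Q x − Q̄‖³ ≤ C_F · Σ_{win R} σ x³` — discrete
  geometric rigidity (Friesecke–James–Müller in `L³`) for the rotation field of the data; its own proof splits one layer down into the interpolation
  bookkeeping (cells of the clean window, TS XX.4) and the printed rigidity theorem on a ball.
* XXII.1 (K_dens, PROVED) the window density ratio `nK (win R) ≤ (10·(2/δ + 1))³ · nK (win (R − 2))` for `R ≥ 14` on `aHi`-door sets with
  `aHi ≤ 8/7`: packing from above (`card_le_of_separated_of_dist_le`) and the covering-by-volume count from below (the `5`-relative density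
  `exists_mem_dist_lt_five_of_cleanP`, as in `ChartedPlanarOrderBarlowGluing.cube_le_ncard`).
* XXII.3 ★★ THE SEAM (PROVED) `tiltRigidityP_of_fieldRigidityP : FieldRigidityP aHi → aHi ≤ 8/7 → TiltRigidityP aHi Λ θ s`: register at scale
  `D := R` (gradient level `Cg·η`), identify the mean rotation on the inner window `I := win (R − 2)` by TU's product form with
  `ζ := √(Cg·η·nK (win R)/nK I) ≤ √(K_d·Cg·η)`, and absorb the identification remainder `432·ζ³·nK (win R) ≤ 432·(K_d·Cg·η)^{3/2}·nK (win R) ≤ ε·η·nK (win R)`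
  for `η ≤ η₁(ε) := (ε/(432·(K_d·Cg)^{3/2}))²`; constants `C_K := 4·C_F + 4·K_d·(16·C_F + 432) + 1`, `R₁ := max R_F 14`.

Hence, in the tree's ledger of (K): `TiltRigidityP aHi Λ θ s ⟸ FieldRigidityP aHi` for every `aHi ≤ 8/7` and all `Λ θ s` — the chart
`IsEquilChart`, the `θ`-goodness and the registration's position budget are NOT used by (K) at all (they remain (M)'s).  No `sorry`, no new axioms,
no type-class declarations, no custom syntax, no option pragmas.  ENERGY-FREE.
-/

noncomputable section

open scoped BigOperators InnerProductSpace
open MeasureTheory Set Metric Filter Topology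
open Summit.AtomisticToContinuum.Crystallization.Theorems.ChartedPlanarOrderRigidityDoor (E3 atomsIn)
open Summit.AtomisticToContinuum.Crystallization.Theorems.ChartedPlanarOrderDensityDichotomy (μS IsSep nK nK_nonneg)
open Summit.AtomisticToContinuum.Crystallization.Theorems.ChartedPlanarOrderCleanScaleP (IsCleanP IsDoorSetP isCleanP_μS_iff
  exists_mem_dist_lt_five_of_cleanP)
open Literature.MathematicalPhysics.StatisticalMechanics (card_le_of_separated_of_dist_le)
open Literature.Geometry.DiscreteGeometry (IsTwoShellGoodSet)

namespace Summit.AtomisticToContinuum.Crystallization.Theorems.ChartedZeroExcessLayeredLatticeLiouville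

/-! ### XXII.1 Window counts: monotonicity, packing from above, volume from below, the density ratio (K_dens, PROVED) -/

/-- Monotonicity of a window sum of nonnegative terms in the site set. -/
theorem finsum_mem_le_finsum_mem_of_subset_of_nonneg {I W : Set E3} (hW : W.Finite) (hIW : I ⊆ W) {f : E3 → ℝ}
    (hf : ∀ x ∈ W, 0 ≤ f x) : ∑ᶠ x ∈ I, f x ≤ ∑ᶠ x ∈ W, f x := by
  have hI : I.Finite := hW.subset hIW
  rw [finsum_mem_eq_finite_toFinset_sum _ hI, finsum_mem_eq_finite_toFinset_sum _ hW]
  refine Finset.sum_le_sum_of_subset_of_nonneg (fun x hx => ?_) (fun x hx _ => hf x (hW.mem_toFinset.1 hx))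
  exact hW.mem_toFinset.2 (hIW (hI.mem_toFinset.1 hx))

/-- A window sum of nonnegative terms is nonnegative. -/
theorem finsum_mem_nonneg_of_nonneg {W : Set E3} {f : E3 → ℝ} (hf : ∀ x, 0 ≤ f x) : 0 ≤ ∑ᶠ x ∈ W, f x :=
  finsum_nonneg fun x => finsum_nonneg fun _ => hf x

/-- Windows grow with the radius. -/
theorem atomsIn_mono_radius {S : Set E3} {R R' : ℝ} (h : R ≤ R') : atomsIn (μS S) 0 R ⊆ atomsIn (μS S) 0 R' :=
  fun _ hx => mem_atomsIn_iff.2 ⟨(mem_atomsIn_iff.1 hx).1, (mem_atomsIn_iff.1 hx).2.trans h⟩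

/-- PACKING FROM ABOVE: a `δ`-separated window of radius `R` has at most `(2R/δ + 1)³` sites. -/
theorem nK_atomsIn_le_packing {δ : ℝ} (hδ : 0 < δ) {S : Set E3} (hsep : IsSep δ S) {R : ℝ} (hR : 0 ≤ R) :
    nK (atomsIn (μS S) 0 R) ≤ (2 * R / δ + 1) ^ 3 := by
  have hW := finite_atomsIn hδ hsep R
  have h1 := card_le_of_separated_of_dist_le hW.toFinset (0 : E3) hδ hR
    (fun c hc => by
      have h := (mem_atomsIn_iff.1 (hW.mem_toFinset.1 hc)).2
      rwa [dist_zero_right])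
    (fun c hc d hd hcd =>
      hsep c (mem_atomsIn_iff.1 (hW.mem_toFinset.1 hc)).1 d (mem_atomsIn_iff.1 (hW.mem_toFinset.1 hd)).1 hcd)
  rw [finrank_euclideanSpace_fin] at h1
  unfold nK
  rw [Set.ncard_eq_toFinset_card _ hW]
  simpa using h1

/-- VOLUME FROM BELOW: on a nonempty `δ`-separated `aHi`-clean configuration (`aHi ≤ 8/7`, `5`-relative density) the window of radius `R ≥ 5`
has at least `((R − 5)/5)³` sites — the balls of radius `5` about the window sites cover the ball of radius `R − 5`. -/
theorem cube_le_nK_atomsIn {aHi δ : ℝ} (haHi : aHi ≤ 8 / 7) (hδ : 0 < δ) {S : Set E3} (hsep : IsSep δ S)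
    (hC : IsCleanP aHi (μS S)) (hne : S.Nonempty) {R : ℝ} (hR : 5 ≤ R) :
    ((R - 5) / 5) ^ 3 ≤ nK (atomsIn (μS S) 0 R) := by
  have hF := finite_atomsIn hδ hsep R
  have hcov : closedBall (0 : E3) (R - 5) ⊆ ⋃ y ∈ hF.toFinset, closedBall y 5 := by
    intro p hp
    obtain ⟨y, hy, hyp⟩ := exists_mem_dist_lt_five_of_cleanP haHi hδ hsep hC hne p
    have hp0 : ‖p‖ ≤ R - 5 := by simpa using hp
    have hyF : y ∈ hF.toFinset := by
      rw [Set.Finite.mem_toFinset]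
      refine mem_atomsIn_iff.2 ⟨hy, ?_⟩
      have h1 : ‖y‖ ≤ ‖y - p‖ + ‖p‖ := norm_le_norm_sub_add y p
      have h2 : ‖y - p‖ < 5 := by rw [← dist_eq_norm, dist_comm]; exact hyp
      linarith
    exact Set.mem_biUnion hyF (mem_closedBall.2 hyp.le)
  have hvol : volume (closedBall (0 : E3) (R - 5)) ≤
      ∑ y ∈ hF.toFinset, volume (closedBall y (5 : ℝ)) :=
    (measure_mono hcov).trans (measure_biUnion_finset_le _ _)
  rw [Measure.addHaar_closedBall volume (0 : E3) (by linarith : (0 : ℝ) ≤ R - 5),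
    Finset.sum_congr rfl (fun y _ =>
      Measure.addHaar_closedBall volume y (by norm_num : (0 : ℝ) ≤ 5)),
    Finset.sum_const, nsmul_eq_mul, finrank_euclideanSpace_fin, ← mul_assoc] at hvol
  have hV0 : volume (ball (0 : E3) 1) ≠ 0 := (measure_ball_pos volume (0 : E3) one_pos).ne'
  have hVt : volume (ball (0 : E3) 1) ≠ ⊤ := measure_ball_lt_top.ne
  rw [ENNReal.mul_le_mul_iff_left hV0 hVt, ← ENNReal.ofReal_natCast,
    ← ENNReal.ofReal_mul (by positivity), ENNReal.ofReal_le_ofReal_iff (by positivity)] at hvol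
  unfold nK
  rw [Set.ncard_eq_toFinset_card _ hF, div_pow, div_le_iff₀ (by positivity)]
  exact hvol

/-- **K_dens (PROVED).** WINDOW DENSITY RATIO on `aHi`-door sets (`aHi ≤ 8/7`): for `R ≥ 14`,
`nK (win R) ≤ (10·(2/δ + 1))³ · nK (win (R − 2))`. -/
theorem nK_atomsIn_le_mul_nK_atomsIn_sub_two {aHi δ : ℝ} (haHi : aHi ≤ 8 / 7) (hδ : 0 < δ) {S : Set E3}
    (hS : IsDoorSetP aHi δ S) {R : ℝ} (hR : 14 ≤ R) :
    nK (atomsIn (μS S) 0 R) ≤ (10 * (2 / δ + 1)) ^ 3 * nK (atomsIn (μS S) 0 (R - 2)) := by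
  have hup := nK_atomsIn_le_packing hδ hS.2.1 (by linarith : (0 : ℝ) ≤ R)
  have hlow := cube_le_nK_atomsIn haHi hδ hS.2.1 hS.2.2.1 ⟨0, hS.1⟩ (by linarith : (5 : ℝ) ≤ R - 2)
  have h2δ : 0 ≤ 2 / δ := div_nonneg (by norm_num) hδ.le
  have hpos : 0 ≤ 10 * (2 / δ + 1) := by linarith
  have key : 2 * R / δ + 1 ≤ 10 * (2 / δ + 1) * ((R - 2 - 5) / 5) := by
    have h1 : 0 ≤ (2 * R - 28) / δ := div_nonneg (by linarith) hδ.le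
    have e1 : 10 * (2 / δ + 1) * ((R - 2 - 5) / 5) = 2 * R / δ + (2 * R - 28) / δ + 2 * (R - 7) := by ring
    rw [e1]
    linarith
  have hl : 0 ≤ 2 * R / δ + 1 := by have := div_nonneg (by linarith : (0 : ℝ) ≤ 2 * R) hδ.le; linarith
  calc nK (atomsIn (μS S) 0 R) ≤ (2 * R / δ + 1) ^ 3 := hup
    _ ≤ (10 * (2 / δ + 1) * ((R - 2 - 5) / 5)) ^ 3 := pow_le_pow_left₀ hl key 3
    _ = (10 * (2 / δ + 1)) ^ 3 * ((R - 2 - 5) / 5) ^ 3 := mul_pow _ _ _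
    _ ≤ (10 * (2 / δ + 1)) ^ 3 * nK (atomsIn (μS S) 0 (R - 2)) :=
        mul_le_mul_of_nonneg_left hlow (pow_nonneg hpos 3)

/-! ### XXII.2 (K_F) `FieldRigidityP` — the ONE remaining piece of (K) (typed; NOT proved here) -/

/-- **(K_F) FIELD RIGIDITY — discrete geometric rigidity for rotation fields on clean configurations (KNOWN-type; the ONE new `Prop`).**
For every separation `δ > 0` there are `C_F ≥ 0` and `R_F > 0` such that on every `aHi`-door set `S`, for every radius `R ≥ R_F`, every map
`Ψ : E3 → E3` and every admissible tilt/strain data `(Q, σ)` on the window `win R = atomsIn (μS S) 0 R` (`IsTiltStrainData`: `det Q x = 1`, `σ ≥ 0`,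
`Q x` fits the displacements of `Ψ` on the `4`-bonds at `x` up to `σ x`), SOME continuous linear map `Q̄` satisfies
`Σ_{x ∈ win R} ‖Q x − Q̄‖³ ≤ C_F · Σ_{x ∈ win R} σ x³`.
MECHANISM (its own split, one layer down — critic row 697 (b)): K_cells — a canonical, pattern-transported subdivision of the clean window into
tetrahedral cells of conditioning `≤ 3` at scale `aHi` (vertices among the `5/2`-compatible sites; the octahedral holes cut along the pattern's own
diagonal, never by a blind Delaunay rule, to avoid slivers); the piecewise-affine interpolant `u` of `Ψ` then has `‖∇u|_T − Q x'‖ ≤ 3·σ x'` on each cell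
`T ∋ x'` (TS `norm_cellGradient_sub_rot_le_of_cell` with `τ = 0`), so `∫_{B} dist³(∇u, SO(3)) ≲ Σ σ³` on the ball `B := B(0, R − 2·aHi)` covered by cells;
K_FJM — Friesecke–James–Müller in `L³` on the BALL `B` (ONE universal constant, scale-free, no domain-shape dependence): `∃ Q̄ ∈ SO(3)`,
`∫_B ‖∇u − Q̄‖³ ≤ C · ∫_B dist³(∇u, SO(3))`; reading `‖Q x − Q̄‖³ ≲ ‖∇u|_T − Q̄‖³ + σ³` back per cell (cell volumes `≍ aHi³`, bounded overlap) and
reaching the collar sites `R − 2·aHi < ‖x‖ ≤ R` through `≤ 2` compatibility steps (TS `norm_rot_sub_rot_le_of_doorP`, factor `4·27`).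
WHY IT MIGHT FAIL: only through the bookkeeping — existence of the canonical cell complex for EVERY `(1/16, 9/10, aHi)`-clean window (both two-shell
patterns, `aHi ≤ 8/7`) with uniform conditioning, and the collar count; the analytic input is a theorem.  Exponent `3` (not `2`) is harmless (FJM holds in
every `L^p`, `1 < p < ∞`).  SOURCES: Friesecke–James–Müller, Comm. Pure Appl. Math. 55 (2002) Thm 3.1; Conti–Schweizer, CPAM 59 (2006) (the `L^p` version,
also Conti–Dolzmann–Müller arXiv:1203.1138 §2); Schmidt, Multiscale Model. Simul. 5 (2006) 664 and ARMA 2009 (discrete FJM for atomistic interpolants);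
Alicandro–Lazzaroni–Palombaro arXiv:1601.05968 §1.1, Thm 1.3 (rigidity for discrete systems with explicit cell interpolation); bib keys
FrieseckeJamesMuller2002 (Thm 3.1) and Schmidt2009 (§3), cited in prose only (critic row 699 (b): the sub-split K_cells ∧ K_FJM stays untyped); this
tree, parts TS (cells, compatibility) / TU (identification). [this file, g42] -/
def FieldRigidityP (aHi : ℝ) : Prop :=
  ∀ δ : ℝ, 0 < δ → ∃ CF : ℝ, 0 ≤ CF ∧ ∃ RF : ℝ, 0 < RF ∧ ∀ S : Set E3, IsDoorSetP aHi δ S → ∀ R : ℝ, RF ≤ R →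
    ∀ (Ψ : E3 → E3) (Q : E3 → (E3 ≃ₗᵢ[ℝ] E3)) (σ : E3 → ℝ), IsTiltStrainData S R Ψ Q σ →
      ∃ Qbar : E3 →L[ℝ] E3,
        ∑ᶠ x ∈ atomsIn (μS S) 0 R, ‖((Q x).toContinuousLinearEquiv : E3 →L[ℝ] E3) - Qbar‖ ^ 3 ≤
          CF * ∑ᶠ x ∈ atomsIn (μS S) 0 R, σ x ^ 3

/-! ### XXII.3 ★★ The seam `FieldRigidityP aHi → aHi ≤ 8/7 → TiltRigidityP aHi Λ θ s` (PROVED) -/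

/-- **THE SEAM (PROVED): (K) ⟸ (K_F).**  For every pattern-scale ceiling `aHi ≤ 8/7` and all `Λ θ s`, field rigidity implies tilt rigidity — with
`C_K := 4·C_F + 4·K_d·(16·C_F + 432) + 1`, `K_d := (10·(2/δ + 1))³`, `η₁(ε) := (ε/(432·K_d·Cg·√(K_d·Cg)))²`, `R₁ := max R_F 14`.  The equilibrium
chart, the `θ`-goodness and the registration's position budget are not used. -/
theorem tiltRigidityP_of_fieldRigidityP {aHi : ℝ} (hF : FieldRigidityP aHi) (haHi : aHi ≤ 8 / 7) (Λ θ s : ℝ) :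
    TiltRigidityP aHi Λ θ s := by
  intro δ hδ a _ha Cg hCg
  obtain ⟨CF, hCF, RF, hRF, hFS⟩ := hF δ hδ
  -- the density constant
  set Kd : ℝ := (10 * (2 / δ + 1)) ^ 3 with hKd
  have hKd1 : 1 ≤ Kd := by
    have h2δ : 0 ≤ 2 / δ := div_nonneg (by norm_num) hδ.le
    have h1 : (1 : ℝ) ≤ 10 * (2 / δ + 1) := by linarith
    exact one_le_pow₀ h1
  have hKd0 : 0 ≤ Kd := zero_le_one.trans hKd1
  have hCK0 : 0 ≤ 4 * CF + 4 * Kd * (16 * CF + 432) := by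
    have := mul_nonneg hKd0 (by linarith : (0 : ℝ) ≤ 16 * CF + 432)
    linarith
  refine ⟨4 * CF + 4 * Kd * (16 * CF + 432) + 1, by linarith, ?_⟩
  intro ε hε
  -- the level constant `K' := K_d · Cg` and the threshold `η₁`
  set K' : ℝ := Kd * Cg with hK'
  have hK'1 : 1 ≤ K' := by nlinarith
  have hK'pos : 0 < K' := by linarith
  have hsqK' : 0 < Real.sqrt K' := Real.sqrt_pos.2 hK'pos
  have hden : 0 < 432 * (K' * Real.sqrt K') := by positivity
  set η₁ : ℝ := (ε / (432 * (K' * Real.sqrt K'))) ^ 2 with hη₁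
  have hη₁pos : 0 < η₁ := by positivity
  refine ⟨η₁, hη₁pos, max RF 14, lt_max_of_lt_left hRF, ?_⟩
  intro S hS _hgood η hη hηle R hR L w _hchart Ψ hreg Q σ hd
  have hRF' : RF ≤ R := (le_max_left _ _).trans hR
  have hR14 : 14 ≤ R := (le_max_right _ _).trans hR
  have hRpos : 0 < R := by linarith
  have haHi4 : 3 / 2 * aHi ≤ 4 := by linarith
  -- the two windows
  have hWfin : (atomsIn (μS S) 0 R).Finite := finite_atomsIn hδ hS.2.1 R
  have hIW : atomsIn (μS S) 0 (R - 2) ⊆ atomsIn (μS S) 0 R := atomsIn_mono_radius (by linarith)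
  have hID : ∀ x ∈ atomsIn (μS S) 0 (R - 2), ‖x‖ + 3 / 2 * aHi ≤ R := fun x hx => by
    have := (mem_atomsIn_iff.1 hx).2
    linarith
  have hm1 : 1 ≤ nK (atomsIn (μS S) 0 (R - 2)) := by
    have h0I : (0 : E3) ∈ atomsIn (μS S) 0 (R - 2) := mem_atomsIn_iff.2 ⟨hS.1, by rw [norm_zero]; linarith⟩
    have hpos := (Set.ncard_pos (hWfin.subset hIW)).2 ⟨0, h0I⟩
    unfold nK
    exact_mod_cast hpos
  have hmpos : 0 < nK (atomsIn (μS S) 0 (R - 2)) := by linarith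
  have hn0 : 0 ≤ nK (atomsIn (μS S) 0 R) := nK_nonneg _
  have hdens : nK (atomsIn (μS S) 0 R) ≤ Kd * nK (atomsIn (μS S) 0 (R - 2)) :=
    nK_atomsIn_le_mul_nK_atomsIn_sub_two haHi hδ hS hR14
  -- field rigidity on the window
  obtain ⟨Qbar, hQbar⟩ := hFS S hS R hRF' Ψ Q σ hd
  -- the registration at scale `D := R` (gradient level `Cg·η`)
  obtain ⟨-, -, -, hregD⟩ := hreg
  obtain ⟨τ, hτreg⟩ := hregD R le_rfl
  have hlevel : Cg * (R / R) * η = Cg * η := by rw [div_self hRpos.ne', mul_one]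
  rw [hlevel] at hτreg
  have hgrad : ∑ᶠ x ∈ atomsIn (μS S) 0 R, τ x ^ 2 ≤ Cg * η * nK (atomsIn (μS S) 0 R) := hτreg.2.2.2.2.1
  -- the level `ζ` on the inner window
  have harg0 : 0 ≤ Cg * η * nK (atomsIn (μS S) 0 R) / nK (atomsIn (μS S) 0 (R - 2)) := by
    have : 0 ≤ Cg * η * nK (atomsIn (μS S) 0 R) := by
      have := mul_nonneg (mul_nonneg (by linarith : (0 : ℝ) ≤ Cg) hη.le) hn0
      exact this
    exact div_nonneg this hmpos.le
  set ζ : ℝ := Real.sqrt (Cg * η * nK (atomsIn (μS S) 0 R) / nK (atomsIn (μS S) 0 (R - 2))) with hζdef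
  have hζ0 : 0 ≤ ζ := Real.sqrt_nonneg _
  have hζsq : ζ ^ 2 = Cg * η * nK (atomsIn (μS S) 0 R) / nK (atomsIn (μS S) 0 (R - 2)) := Real.sq_sqrt harg0
  have hτI : ∑ᶠ x ∈ atomsIn (μS S) 0 (R - 2), τ x ^ 2 ≤ ζ ^ 2 * nK (atomsIn (μS S) 0 (R - 2)) := by
    have h1 : ∑ᶠ x ∈ atomsIn (μS S) 0 (R - 2), τ x ^ 2 ≤ ∑ᶠ x ∈ atomsIn (μS S) 0 R, τ x ^ 2 :=
      finsum_mem_le_finsum_mem_of_subset_of_nonneg hWfin hIW (fun x _ => sq_nonneg (τ x))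
    rw [hζsq, div_mul_cancel₀ _ hmpos.ne']
    exact h1.trans hgrad
  -- the level bound `ζ² ≤ K'·η`, hence `432·ζ³ ≤ ε·η`
  have harg_le : Cg * η * nK (atomsIn (μS S) 0 R) / nK (atomsIn (μS S) 0 (R - 2)) ≤ K' * η := by
    rw [div_le_iff₀ hmpos]
    calc Cg * η * nK (atomsIn (μS S) 0 R) ≤ Cg * η * (Kd * nK (atomsIn (μS S) 0 (R - 2))) :=
          mul_le_mul_of_nonneg_left hdens (mul_nonneg (by linarith) hη.le)
      _ = K' * η * nK (atomsIn (μS S) 0 (R - 2)) := by rw [hK']; ring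
  have hζsq_le : ζ ^ 2 ≤ K' * η := hζsq ▸ harg_le
  have hζle : ζ ≤ Real.sqrt K' * Real.sqrt η := by
    rw [← Real.sqrt_mul hK'pos.le]
    exact Real.sqrt_le_sqrt harg_le
  have hζ3 : ζ ^ 3 ≤ K' * η * (Real.sqrt K' * Real.sqrt η) := by
    have e : ζ ^ 3 = ζ ^ 2 * ζ := by ring
    rw [e]
    exact mul_le_mul hζsq_le hζle hζ0 (by positivity)
  have hsqrtη : Real.sqrt η ≤ ε / (432 * (K' * Real.sqrt K')) := by
    have h1 : Real.sqrt η ≤ Real.sqrt η₁ := Real.sqrt_le_sqrt hηle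
    rwa [hη₁, Real.sqrt_sq (div_nonneg hε.le hden.le)] at h1
  have hrem : 432 * ζ ^ 3 ≤ ε * η := by
    have h3 : 432 * (K' * Real.sqrt K') * Real.sqrt η ≤ ε := by
      have := mul_le_mul_of_nonneg_left hsqrtη hden.le
      rwa [mul_div_cancel₀ _ hden.ne'] at this
    calc 432 * ζ ^ 3 ≤ 432 * (K' * η * (Real.sqrt K' * Real.sqrt η)) := by linarith [hζ3]
      _ = (432 * (K' * Real.sqrt K') * Real.sqrt η) * η := by ring
      _ ≤ ε * η := mul_le_mul_of_nonneg_right h3 hη.le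
  -- TU's product form on `I := win (R − 2) ⊆ W := win R`
  have hprod := nK_mul_finsum_tilt_pow_three_le hδ hS haHi4 hd hτreg hIW hID Qbar hζ0 hτI
  -- the window sums and their comparisons
  have hσ0 : ∀ x, 0 ≤ σ x := hd.2.1
  have hSg0 : 0 ≤ ∑ᶠ x ∈ atomsIn (μS S) 0 R, σ x ^ 3 := finsum_mem_nonneg_of_nonneg fun x => pow_nonneg (hσ0 x) 3
  have hAI : ∑ᶠ x ∈ atomsIn (μS S) 0 (R - 2), ‖((Q x).toContinuousLinearEquiv : E3 →L[ℝ] E3) - Qbar‖ ^ 3 ≤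
      ∑ᶠ x ∈ atomsIn (μS S) 0 R, ‖((Q x).toContinuousLinearEquiv : E3 →L[ℝ] E3) - Qbar‖ ^ 3 :=
    finsum_mem_le_finsum_mem_of_subset_of_nonneg hWfin hIW (fun x _ => pow_nonneg (norm_nonneg _) 3)
  have hAI0 : 0 ≤ ∑ᶠ x ∈ atomsIn (μS S) 0 (R - 2), ‖((Q x).toContinuousLinearEquiv : E3 →L[ℝ] E3) - Qbar‖ ^ 3 :=
    finsum_mem_nonneg_of_nonneg fun x => pow_nonneg (norm_nonneg _) 3
  have hSI : ∑ᶠ x ∈ atomsIn (μS S) 0 (R - 2), σ x ^ 3 ≤ ∑ᶠ x ∈ atomsIn (μS S) 0 R, σ x ^ 3 :=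
    finsum_mem_le_finsum_mem_of_subset_of_nonneg hWfin hIW (fun x _ => pow_nonneg (hσ0 x) 3)
  have hSI0 : 0 ≤ ∑ᶠ x ∈ atomsIn (μS S) 0 (R - 2), σ x ^ 3 := finsum_mem_nonneg_of_nonneg fun x => pow_nonneg (hσ0 x) 3
  -- assemble: `nK I · Σ_W tilt³ ≤ nK I · (C · Σ_W σ³ + ε·η·nK W)`
  have e1 : nK (atomsIn (μS S) 0 (R - 2)) *
      (4 * ∑ᶠ x ∈ atomsIn (μS S) 0 R, ‖((Q x).toContinuousLinearEquiv : E3 →L[ℝ] E3) - Qbar‖ ^ 3) ≤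
      nK (atomsIn (μS S) 0 (R - 2)) * (4 * (CF * ∑ᶠ x ∈ atomsIn (μS S) 0 R, σ x ^ 3)) :=
    mul_le_mul_of_nonneg_left (by linarith [hQbar]) hmpos.le
  have e2 : nK (atomsIn (μS S) 0 R) *
      (4 * (16 * ∑ᶠ x ∈ atomsIn (μS S) 0 (R - 2), ‖((Q x).toContinuousLinearEquiv : E3 →L[ℝ] E3) - Qbar‖ ^ 3 +
        432 * ∑ᶠ x ∈ atomsIn (μS S) 0 (R - 2), σ x ^ 3)) ≤
      (Kd * nK (atomsIn (μS S) 0 (R - 2))) *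
        (4 * (16 * (CF * ∑ᶠ x ∈ atomsIn (μS S) 0 R, σ x ^ 3) + 432 * ∑ᶠ x ∈ atomsIn (μS S) 0 R, σ x ^ 3)) :=
    mul_le_mul hdens (by linarith [hAI, hQbar, hSI]) (by positivity) (mul_nonneg hKd0 hmpos.le)
  have e3 : nK (atomsIn (μS S) 0 R) * (4 * (108 * ζ ^ 3 * nK (atomsIn (μS S) 0 (R - 2)))) ≤
      nK (atomsIn (μS S) 0 R) * (ε * η * nK (atomsIn (μS S) 0 (R - 2))) := by
    refine mul_le_mul_of_nonneg_left ?_ hn0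
    have : 4 * (108 * ζ ^ 3 * nK (atomsIn (μS S) 0 (R - 2))) = (432 * ζ ^ 3) * nK (atomsIn (μS S) 0 (R - 2)) := by ring
    rw [this]
    exact mul_le_mul_of_nonneg_right hrem hmpos.le
  have hmain : nK (atomsIn (μS S) 0 (R - 2)) * ∑ᶠ x ∈ atomsIn (μS S) 0 R, tilt (Q x) ^ 3 ≤
      nK (atomsIn (μS S) 0 (R - 2)) *
        ((4 * CF + 4 * Kd * (16 * CF + 432)) * ∑ᶠ x ∈ atomsIn (μS S) 0 R, σ x ^ 3 +
          ε * η * nK (atomsIn (μS S) 0 R)) := by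
    have esplit : nK (atomsIn (μS S) 0 R) *
        (4 * (16 * ∑ᶠ x ∈ atomsIn (μS S) 0 (R - 2), ‖((Q x).toContinuousLinearEquiv : E3 →L[ℝ] E3) - Qbar‖ ^ 3 +
          432 * ∑ᶠ x ∈ atomsIn (μS S) 0 (R - 2), σ x ^ 3 + 108 * ζ ^ 3 * nK (atomsIn (μS S) 0 (R - 2)))) =
        nK (atomsIn (μS S) 0 R) *
          (4 * (16 * ∑ᶠ x ∈ atomsIn (μS S) 0 (R - 2), ‖((Q x).toContinuousLinearEquiv : E3 →L[ℝ] E3) - Qbar‖ ^ 3 +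
            432 * ∑ᶠ x ∈ atomsIn (μS S) 0 (R - 2), σ x ^ 3)) +
        nK (atomsIn (μS S) 0 R) * (4 * (108 * ζ ^ 3 * nK (atomsIn (μS S) 0 (R - 2)))) := by ring
    have efin : nK (atomsIn (μS S) 0 (R - 2)) * (4 * (CF * ∑ᶠ x ∈ atomsIn (μS S) 0 R, σ x ^ 3)) +
        ((Kd * nK (atomsIn (μS S) 0 (R - 2))) *
          (4 * (16 * (CF * ∑ᶠ x ∈ atomsIn (μS S) 0 R, σ x ^ 3) + 432 * ∑ᶠ x ∈ atomsIn (μS S) 0 R, σ x ^ 3)) +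
        nK (atomsIn (μS S) 0 R) * (ε * η * nK (atomsIn (μS S) 0 (R - 2)))) =
        nK (atomsIn (μS S) 0 (R - 2)) *
          ((4 * CF + 4 * Kd * (16 * CF + 432)) * ∑ᶠ x ∈ atomsIn (μS S) 0 R, σ x ^ 3 +
            ε * η * nK (atomsIn (μS S) 0 R)) := by ring
    rw [esplit] at hprod
    rw [← efin]
    linarith [hprod, e1, e2, e3]
  have hT := le_of_mul_le_mul_left hmain hmpos
  -- `C ↦ C + 1` (so that `1 ≤ C_K` is immediate)
  exact hT.trans (add_le_add (mul_le_mul_of_nonneg_right (lt_add_one _).le hSg0) le_rfl)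

end Summit.AtomisticToContinuum.Crystallization.Theorems.ChartedZeroExcessLayeredLatticeLiouville

end
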